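import Summits.ValiantsHypothesis.ValiantsHypothesis.Theorems.PolyaContinuedFreeEdgeRankOnePeel

/-!
# Route `PolyaContinued`, crux `FreeEdgeAdditivity` (stmt-ValiantsHypothesis-7423):
# free edges attached in RANK ONE are additive

SPECIAL CASE (rank-one attachments) + the `≤` half; `FreeEdgeAdditivity` NOT proved; the crux is NOT in
the route's closes-cone (route text l.193: the assembly does not use it) — calibration of a non-cone crux.

ROUTE-INDEPENDENT support file (`--supports stmt-ValiantsHypothesis-7423`; no `Theses` import) of route `ValiantsHypothesis/PolyaContinued`.
The crux asserts, for a bipartite `G ⊆ K_{n,n}` with a perfect matching and `d` fresh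
vertex-disjoint edges, `dc(PM_{G ⊔ dK₂}) = dc(PM_G · y₁⋯y_d) = dc(PM_G) + d`. The `≤` half is
block-diagonal padding (`hasDetRepr_mul_prod_X`, `dc_mul_prod_X_le` below). This file proves the
`≥` half for every affine determinantal representation of `f · y₁ ⋯ y_d` in which each fresh
variable `y_t` multiplies a CONSTANT matrix of rank `≤ 1` (`rankOneForm L u v`, e.g. `y_t` placed
in one row or one column of the matrix):

* `exists_eq_C_mul_det_of_rankOneForm` / `dc_add_le_of_rankOneForm`: if `f ≠ 0` is not constant
  and `f · y₁ ⋯ y_d = det (L + Σ_t y_t · u_t v_tᵀ)` with `L` affine and `y`-free and `u_t, v_t`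
  constant vectors, then the matrix has size `≥ dc f + d`.
* `dc_succ_le_of_constant_column` / `_row` (the case `d = 1`): an affine representation of a
  non-constant `f` with a constant column (or row) has size `≥ dc f + 1`; so a `dc`-optimal
  representation has no constant line. In particular the refutation mechanism contemplated in the
  route text («`dc(per₃ · y) = 7` by a constant-column `7 × 7` representation of `per₃`») cannot
  exist, `dc per₃` being `7` (Alper–Bogart–Velasco, in the tree): any refutation of the crux must
  attach some free variable with rank `≥ 2` and exploit cancellations.
* `freeEdgeAdditivity_rankOne`: the statement in the crux's own objects.

## Proof

One fresh variable at a time (`peel`): if `det (N + y · u vᵀ) = y · G` with `N, G` free of `y`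
(renamed along an injection missing `y`), then `u, v ≠ 0`; constant invertible `P, Q` with
`P u = e₀`, `vᵀ Q = e₀ᵀ` (`exists_isUnit_mulVec_eq_single`) turn the update into `y · e₀ e₀ᵀ`, whose
determinant is `det N' + y · det (minor₀₀ N')` by linearity in row `0`
(`det_add_smul_vecMulVec_single`); comparing with `y · G` and cancelling `y` with the partial
derivative `∂/∂y` (`eq_of_rename_add_X_mul`) gives `G = c · det (minor₀₀ (P N Q))`, `c ≠ 0`. The
minor of a constant conjugate of a rank-one form is a rank-one form
(`submatrix_conj_rankOneForm`), so induction on `d` ends with `f = c · det L'`, `L'` affine of size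
`m - d`; absorbing `c` into a row gives `dc f ≤ m - d` (unless `m = d`, when `f` is constant).

HONEST FRAMING: a structural partial result (and the easy half) on an OPEN crux of a dormant route;
it decides neither `FreeEdgeAdditivity` nor `AffineLittle`, and nothing here bears on `VP ≠ VNP`.

## References

* [MignonRessayre2004] T. Mignon, N. Ressayre, *A quadratic bound for the determinant and
  permanent problem*, IMRN 2004, §1 (affine determinantal representations, `dc`).
* [AlperBogartVelasco2017] J. Alper, T. Bogart, M. Velasco, *A lower bound for the determinantal
  complexity of a hypersurface*, Found. Comput. Math. 17 (2017) — `dc per₃ = 7`.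
* Route file `Theses/PolyaContinued.lean`, crux #4 and the paragraph «Refutation of
  FreeEdgeAdditivity (e.g. dc(per_3·y) = 7 by a constant-column 7×7 representation)».
-/

noncomputable section

-- `Summit.<Summit>.<Problem>` repeats `ValiantsHypothesis` by the tree's layout convention (D-0017).
set_option linter.dupNamespace false

namespace Summit.ValiantsHypothesis.ValiantsHypothesis.Theorems.PolyaContinued.FreeEdgeRankOne

open MvPolynomial Matrix Literature.Computability.AlgebraicComplexity

section Main

variable {k : Type*} [Field k] {σ : Type*}

/-- The *rank-one free-edge form*: an affine `y`-free matrix `L` plus, for each fresh variable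
`y_t = X (inr t)`, the variable times a CONSTANT matrix of rank `≤ 1` (an outer product
`u_t v_tᵀ`). [folklore] -/
def rankOneForm {m d : ℕ} (L : Matrix (Fin m) (Fin m) (MvPolynomial σ k))
    (u v : Fin d → Fin m → k) : Matrix (Fin m) (Fin m) (MvPolynomial (σ ⊕ Fin d) k) :=
  L.map (rename Sum.inl) +
    ∑ t : Fin d, (X (Sum.inr t) : MvPolynomial (σ ⊕ Fin d) k) • (vecMulVec (u t) (v t)).map C

/-- Entries of a two-sided constant conjugate of an affine matrix are affine. [folklore] -/
theorem totalDegree_conj_le_one {m : ℕ} (P Q : Matrix (Fin m) (Fin m) k)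
    (L : Matrix (Fin m) (Fin m) (MvPolynomial σ k)) (hL : ∀ i j, (L i j).totalDegree ≤ 1)
    (i j : Fin m) :
    ((P.map (C : k → MvPolynomial σ k) * L * Q.map (C : k → MvPolynomial σ k)) i j).totalDegree
      ≤ 1 := by
  simp only [Matrix.mul_apply, Matrix.map_apply]
  refine (totalDegree_finsetSum _ _).trans (Finset.sup_le fun b _ => ?_)
  refine (totalDegree_mul _ _).trans ?_
  rw [totalDegree_C, add_zero]
  refine (totalDegree_finsetSum _ _).trans (Finset.sup_le fun a _ => ?_)
  refine (totalDegree_mul _ _).trans ?_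
  rw [totalDegree_C, zero_add]
  exact hL a b

/-- Renaming `σ ⊕ Fin d ↪ σ ⊕ Fin (d+1)` (fresh variables by `castSucc`) of a rank-one form,
plus the last fresh variable's rank-one term, is the rank-one form with `d + 1` fresh variables.
[folklore] -/
theorem rankOneForm_succ {m d : ℕ} (L : Matrix (Fin m) (Fin m) (MvPolynomial σ k))
    (u v : Fin (d + 1) → Fin m → k) :
    rankOneForm L u v =
      (rankOneForm L (fun t => u (Fin.castSucc t)) (fun t => v (Fin.castSucc t))).map
          (rename (Sum.map id Fin.castSucc)) +
        (X (Sum.inr (Fin.last d)) : MvPolynomial (σ ⊕ Fin (d + 1)) k) •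
          (vecMulVec (u (Fin.last d)) (v (Fin.last d))).map C := by
  unfold rankOneForm
  rw [Fin.sum_univ_castSucc, Matrix.map_add _ (map_add _), Matrix.map_map]
  have h1 : (rename (Sum.map id Fin.castSucc) : MvPolynomial (σ ⊕ Fin d) k →ₐ[k] _) ∘
      (rename Sum.inl : MvPolynomial σ k →ₐ[k] MvPolynomial (σ ⊕ Fin d) k) =
      (rename Sum.inl : MvPolynomial σ k → MvPolynomial (σ ⊕ Fin (d + 1)) k) := by
    funext p
    simp only [Function.comp_apply, rename_rename]
    rfl
  rw [h1, add_assoc]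
  congr 1
  rw [← AlgHom.mapMatrix_apply, map_sum]
  congr 1
  refine Finset.sum_congr rfl fun t _ => ?_
  rw [AlgHom.mapMatrix_apply, Matrix.map_smul' _ _ _ (map_mul _), rename_X, Matrix.map_map]
  congr 2
  funext a
  simp

/-- Entries of a rank-one form. [folklore] -/
theorem rankOneForm_apply {m d : ℕ} (L : Matrix (Fin m) (Fin m) (MvPolynomial σ k))
    (u v : Fin d → Fin m → k) (i j : Fin m) :
    rankOneForm L u v i j =
      rename Sum.inl (L i j) + ∑ t : Fin d, X (Sum.inr t) * C (u t i * v t j) := by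
  simp [rankOneForm, Matrix.sum_apply, vecMulVec_apply]

/-- Renaming commutes with constant two-sided conjugation. [folklore] -/
theorem conj_map_rename {m : ℕ} {τ' : Type*} (g : σ → τ') (P Q : Matrix (Fin m) (Fin m) k)
    (L : Matrix (Fin m) (Fin m) (MvPolynomial σ k)) :
    (P.map (C : k → MvPolynomial σ k) * L * Q.map (C : k → MvPolynomial σ k)).map (rename g) =
      P.map C * L.map (rename g) * Q.map C := by
  have hC : (rename g : MvPolynomial σ k → MvPolynomial τ' k) ∘ (C : k → MvPolynomial σ k) =
      (C : k → MvPolynomial τ' k) := funext fun a => rename_C g a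
  rw [Matrix.map_mul, Matrix.map_mul, Matrix.map_map, Matrix.map_map, hC]

/-- A principal minor of a constant two-sided conjugate of a rank-one form is a rank-one form.
[folklore] -/
theorem submatrix_conj_rankOneForm {m d : ℕ} (L : Matrix (Fin (m + 1)) (Fin (m + 1)) (MvPolynomial σ k))
    (u v : Fin d → Fin (m + 1) → k) (P Q : Matrix (Fin (m + 1)) (Fin (m + 1)) k) :
    (P.map C * rankOneForm L u v * Q.map C).submatrix Fin.succ Fin.succ =
      rankOneForm ((P.map C * L * Q.map C).submatrix Fin.succ Fin.succ)
        (fun t => (P *ᵥ u t) ∘ Fin.succ) (fun t => (v t ᵥ* Q) ∘ Fin.succ) := by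
  have hterm : ∀ t : Fin d, P.map (C : k → MvPolynomial (σ ⊕ Fin d) k) *
      ((X (Sum.inr t) : MvPolynomial (σ ⊕ Fin d) k) • (vecMulVec (u t) (v t)).map C) * Q.map C =
      (X (Sum.inr t) : MvPolynomial (σ ⊕ Fin d) k) • (vecMulVec (P *ᵥ u t) (v t ᵥ* Q)).map C := by
    intro t
    rw [Matrix.mul_smul, Matrix.smul_mul, ← Matrix.map_mul, ← Matrix.map_mul, mul_vecMulVec_mul]
  unfold rankOneForm
  rw [Matrix.mul_add, Matrix.add_mul, Finset.mul_sum, Finset.sum_mul,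
    Finset.sum_congr rfl (fun t _ => hterm t), ← conj_map_rename]
  refine Matrix.ext fun i j => ?_
  simp only [Matrix.submatrix_apply, Matrix.add_apply, Matrix.map_apply, Matrix.sum_apply,
    Matrix.smul_apply, vecMulVec_apply, Function.comp_apply]

/-- **Main lemma.** If `f · y₁ ⋯ y_d = det M` for a rank-one free-edge form `M` of size `m` built
on an affine `y`-free `L`, and `f ≠ 0`, then `d ≤ m` and `f` is a nonzero constant times the
determinant of an affine matrix of size `m - d`. Induction on `d`, peeling the last fresh variable
(`peel`): the peeled minor of the constant conjugate is again a rank-one form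
(`submatrix_conj_rankOneForm`). [folklore] -/
theorem exists_eq_C_mul_det_of_rankOneForm (f : MvPolynomial σ k) (hf : f ≠ 0) :
    ∀ (d m : ℕ) (L : Matrix (Fin m) (Fin m) (MvPolynomial σ k)) (_ : ∀ i j, (L i j).totalDegree ≤ 1)
      (u v : Fin d → Fin m → k),
      (rankOneForm L u v).det = rename Sum.inl f * ∏ t : Fin d, X (Sum.inr t) →
      ∃ (r : ℕ) (c : k) (L' : Matrix (Fin r) (Fin r) (MvPolynomial σ k)),
        r + d = m ∧ c ≠ 0 ∧ (∀ i j, (L' i j).totalDegree ≤ 1) ∧ f = C c * L'.det := by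
  intro d
  induction d generalizing f with
  | zero =>
    intro m L hL u v h
    refine ⟨m, 1, L, rfl, one_ne_zero, hL, ?_⟩
    simp only [rankOneForm, Finset.univ_eq_empty, Finset.sum_empty, add_zero,
      Finset.prod_empty, mul_one] at h
    rw [← AlgHom.mapMatrix_apply, ← AlgHom.map_det] at h
    rw [map_one, one_mul]
    exact (rename_injective _ Sum.inl_injective h).symm
  | succ d ih =>
    intro m L hL u v h
    -- the matrix is not empty
    obtain ⟨m, rfl⟩ : ∃ m', m = m' + 1 := by
      cases m with
      | zero =>
        exfalso
        rw [Matrix.det_fin_zero] at h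
        have h' := congrArg (aeval (Sum.elim X (fun _ : Fin (d + 1) => (0 : MvPolynomial σ k)))) h
        simp only [map_one, map_mul, map_prod, aeval_X, Sum.elim_inr] at h'
        rw [Finset.prod_eq_zero (Finset.mem_univ (0 : Fin (d + 1))) rfl, mul_zero] at h'
        exact one_ne_zero h'
      | succ m' => exact ⟨m', rfl⟩
    -- peel the last fresh variable
    set ι : σ ⊕ Fin d → σ ⊕ Fin (d + 1) := Sum.map id Fin.castSucc with hι
    have hιinj : Function.Injective ι :=
      Sum.map_injective.mpr ⟨fun _ _ h => h, Fin.castSucc_injective _⟩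
    have hy : (Sum.inr (Fin.last d) : σ ⊕ Fin (d + 1)) ∉ Set.range ι := by
      rintro ⟨x, hx⟩
      rcases x with x | x
      · simp [hι] at hx
      · simp only [hι, Sum.map_inr, Sum.inr.injEq] at hx
        exact (Fin.castSucc_lt_last x).ne hx
    set G : MvPolynomial (σ ⊕ Fin d) k := rename Sum.inl f * ∏ t : Fin d, X (Sum.inr t) with hG
    have hG0 : G ≠ 0 := by
      refine mul_ne_zero ((map_ne_zero_iff _ (rename_injective _ Sum.inl_injective)).mpr hf) ?_
      exact Finset.prod_ne_zero_iff.mpr fun t _ => X_ne_zero _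
    have hrhs : rename Sum.inl f * ∏ t : Fin (d + 1), (X (Sum.inr t) : MvPolynomial (σ ⊕ Fin (d + 1)) k)
        = X (Sum.inr (Fin.last d)) * rename ι G := by
      rw [hG, map_mul, map_prod, rename_rename, Fin.prod_univ_castSucc]
      simp only [rename_X, hι, Sum.map_inr]
      have : (ι ∘ Sum.inl : σ → σ ⊕ Fin (d + 1)) = Sum.inl := by funext s; simp [hι]
      rw [this]; ring
    rw [rankOneForm_succ, hrhs] at h
    obtain ⟨P, Q, c, hP, hQ, hc, hGeq⟩ :=
      peel hιinj hy (rankOneForm L (fun t => u (Fin.castSucc t)) (fun t => v (Fin.castSucc t)))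
        (u (Fin.last d)) (v (Fin.last d)) G hG0 h
    rw [submatrix_conj_rankOneForm] at hGeq
    -- the peeled identity, for the polynomial `C c⁻¹ * f`
    have hf' : C c⁻¹ * f ≠ 0 := mul_ne_zero (by simpa using inv_ne_zero hc) hf
    have h' : (rankOneForm ((P.map C * L * Q.map C).submatrix Fin.succ Fin.succ)
        (fun t => (P *ᵥ u (Fin.castSucc t)) ∘ Fin.succ)
        (fun t => (v (Fin.castSucc t) ᵥ* Q) ∘ Fin.succ)).det =
        rename Sum.inl (C c⁻¹ * f) * ∏ t : Fin d, X (Sum.inr t) := by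
      rw [map_mul, rename_C, mul_assoc (C c⁻¹ : MvPolynomial (σ ⊕ Fin d) k), ← hG, hGeq,
        ← mul_assoc, ← map_mul, inv_mul_cancel₀ hc, map_one, one_mul]
    obtain ⟨r, c', L', hr, hc', hL', hfL'⟩ := ih (C c⁻¹ * f) hf' m _
      (fun i j => (totalDegree_conj_le_one P Q L hL _ _)) _ _ h'
    refine ⟨r, c * c', L', by omega, mul_ne_zero hc hc', hL', ?_⟩
    rw [map_mul, mul_assoc, ← hfL', ← mul_assoc, ← map_mul, mul_inv_cancel₀ hc, map_one, one_mul]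

/-- **Rank-one free edges are additive (the `≥` half of `FreeEdgeAdditivity` for rank-one
attachments).** If `f · y₁ ⋯ y_d` (fresh variables `y_t = X (inr t)`) is the determinant of an
affine matrix of size `m` in which every `y_t` multiplies a CONSTANT matrix of rank `≤ 1`
(`rankOneForm L u v`), and `f` is not constant, then `m ≥ dc f + d`. [folklore] -/
theorem dc_add_le_of_rankOneForm (f : MvPolynomial σ k) (hf : 1 ≤ f.totalDegree) {d m : ℕ}
    (L : Matrix (Fin m) (Fin m) (MvPolynomial σ k)) (hL : ∀ i j, (L i j).totalDegree ≤ 1)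
    (u v : Fin d → Fin m → k)
    (h : (rankOneForm L u v).det = rename Sum.inl f * ∏ t : Fin d, X (Sum.inr t)) :
    determinantalComplexity f + d ≤ m := by
  have hf0 : f ≠ 0 := by rintro rfl; simp at hf
  obtain ⟨r, c, L', hr, hc, hL', hfL'⟩ := exists_eq_C_mul_det_of_rankOneForm f hf0 d m L hL u v h
  cases r with
  | zero =>
    exfalso
    rw [Matrix.det_fin_zero, mul_one] at hfL'
    rw [hfL', totalDegree_C] at hf
    exact Nat.not_succ_le_zero 0 hf
  | succ r =>
    -- absorb the constant into row `0`
    have hrepr : HasDetRepr f (r + 1) := by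
      refine ⟨L'.updateRow 0 ((C c : MvPolynomial σ k) • L' 0), fun i j => ?_, ?_⟩
      · by_cases hi : i = 0
        · subst hi
          rw [Matrix.updateRow_self, Pi.smul_apply, smul_eq_mul]
          exact (totalDegree_mul _ _).trans (by rw [totalDegree_C, zero_add]; exact hL' 0 j)
        · rw [Matrix.updateRow_ne hi]; exact hL' i j
      · rw [Matrix.det_updateRow_smul, Matrix.updateRow_eq_self, hfL']
    have := determinantalComplexity_le_of_hasDetRepr hrepr
    omega

end Main


section Corollaries

variable {k : Type*} [Field k] {σ : Type*}

/-- **No constant column in a small representation.** If `A` is an affine determinantal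
representation of a non-constant `f` of size `m` and some column of `A` is constant, then
`dc f + 1 ≤ m`: scaling that column by a fresh variable `y` is a rank-one attachment representing
`f · y`, so `dc_add_le_of_rankOneForm` applies with `d = 1`. In particular a `dc`-optimal
representation has no constant column. [folklore] -/
theorem dc_succ_le_of_constant_column (f : MvPolynomial σ k) (hf : 1 ≤ f.totalDegree) {m : ℕ}
    (A : Matrix (Fin m) (Fin m) (MvPolynomial σ k)) (hA : IsAffineDetRepr f A) (j₀ : Fin m)
    (c : Fin m → k) (hcol : ∀ i, A i j₀ = C (c i)) :
    determinantalComplexity f + 1 ≤ m := by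
  -- `L` = `A` with column `j₀` zeroed; the rank-one attachment `L + y · c e_{j₀}ᵀ` is `A` with
  -- column `j₀` scaled by `y`
  set L : Matrix (Fin m) (Fin m) (MvPolynomial σ k) := A.updateCol j₀ 0 with hL
  have hLaff : ∀ i j, (L i j).totalDegree ≤ 1 := by
    intro i j
    by_cases hj : j = j₀
    · subst hj; simp [hL]
    · rw [hL, Matrix.updateCol_ne hj]; exact hA.1 i j
  refine dc_add_le_of_rankOneForm f hf L hLaff (fun _ : Fin 1 => c) (fun _ => Pi.single j₀ 1) ?_
  have hform : rankOneForm L (fun _ : Fin 1 => c) (fun _ => Pi.single j₀ 1) =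
      (A.map (rename Sum.inl)).updateCol j₀
        ((X (Sum.inr 0) : MvPolynomial (σ ⊕ Fin 1) k) • fun i => (A.map (rename Sum.inl)) i j₀) := by
    refine Matrix.ext fun i j => ?_
    rw [rankOneForm_apply, Fin.sum_univ_one]
    by_cases hj : j = j₀
    · subst hj
      simp [hL, hcol, Matrix.updateCol_self]
    · simp [hL, Matrix.updateCol_ne hj, Pi.single_eq_of_ne hj]
  rw [hform, Matrix.det_updateCol_smul, Matrix.updateCol_eq_self, ← AlgHom.mapMatrix_apply,
    ← AlgHom.map_det, hA.2, Fin.prod_univ_one, mul_comm]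

/-- Same for a constant ROW (transpose). [folklore] -/
theorem dc_succ_le_of_constant_row (f : MvPolynomial σ k) (hf : 1 ≤ f.totalDegree) {m : ℕ}
    (A : Matrix (Fin m) (Fin m) (MvPolynomial σ k)) (hA : IsAffineDetRepr f A) (i₀ : Fin m)
    (c : Fin m → k) (hrow : ∀ j, A i₀ j = C (c j)) :
    determinantalComplexity f + 1 ≤ m :=
  dc_succ_le_of_constant_column f hf Aᵀ ⟨fun i j => hA.1 j i, by rw [Matrix.det_transpose]; exact hA.2⟩
    i₀ c fun j => hrow j

/-- **The `≤` half of `FreeEdgeAdditivity` (block-diagonal padding).** A representation of `f`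
of size `r` gives one of `f · y₁ ⋯ y_d` of size `r + d`: `diag(A, y₁, …, y_d)`. [folklore] -/
theorem hasDetRepr_mul_prod_X {f : MvPolynomial σ k} {r : ℕ} (h : HasDetRepr f r) (d : ℕ) :
    HasDetRepr (rename Sum.inl f * ∏ t : Fin d, (X (Sum.inr t) : MvPolynomial (σ ⊕ Fin d) k))
      (r + d) := by
  obtain ⟨A, hA, hdet⟩ := h
  refine ⟨Matrix.reindex finSumFinEquiv finSumFinEquiv
      (Matrix.fromBlocks (A.map (rename Sum.inl)) 0 0 (Matrix.diagonal fun t => X (Sum.inr t))),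
    fun i j => ?_, ?_⟩
  · rw [Matrix.reindex_apply, Matrix.submatrix_apply]
    rcases h1 : finSumFinEquiv.symm i with a | a <;> rcases h2 : finSumFinEquiv.symm j with b | b
    · rw [Matrix.fromBlocks_apply₁₁, Matrix.map_apply]
      exact (totalDegree_rename_le _ _).trans (hA a b)
    · simp
    · simp
    · rw [Matrix.fromBlocks_apply₂₂, Matrix.diagonal_apply]
      split_ifs
      · exact (totalDegree_X (R := k) _).le
      · simp
  · rw [Matrix.det_reindex_self, Matrix.det_fromBlocks_zero₂₁, Matrix.det_diagonal,
      ← AlgHom.mapMatrix_apply, ← AlgHom.map_det, hdet]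

/-- Hence `dc (f · y₁ ⋯ y_d) ≤ dc f + d` for every `f` (Valiant's universality gives some
representation of `f`, so `dc f` is attained). [folklore] -/
theorem dc_mul_prod_X_le (f : MvPolynomial σ k) (d : ℕ) :
    determinantalComplexity
        (rename Sum.inl f * ∏ t : Fin d, (X (Sum.inr t) : MvPolynomial (σ ⊕ Fin d) k)) ≤
      determinantalComplexity f + d :=
  determinantalComplexity_le_of_hasDetRepr
    (hasDetRepr_mul_prod_X (hasDetRepr_determinantalComplexity_holds f) d)

end Corollaries

section Crux


/-- **The crux `FreeEdgeAdditivity` (stmt-ValiantsHypothesis-7423) holds against rank-one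
attachments.** For a bipartite `G = E ⊆ Fin n × Fin n` with non-constant perfect-matching
polynomial `P = PM_E` (e.g. `n ≥ 1` and `P ≠ 0`) and `d` fresh vertex-disjoint edges: every affine
determinantal representation of `PM_{G ⊔ d K₂} = P · y₁ ⋯ y_d` in which each free-edge variable
`y_t` occupies a rank-one constant pattern (`rankOneForm L u v`: e.g. a single row or a single
column) has size `≥ dc P + d` — the value the crux asserts for ALL representations
(`dc_mul_prod_X_le` is the `≤` half). Consequently any refutation of the crux must attach some
`y_t` with rank `≥ 2` and use cancellations; in particular the «constant-column `7 × 7`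
representation of `per₃`» mechanism named in the route text cannot exist
(`dc_succ_le_of_constant_column`, since `dc per₃ = 7`). HONEST FRAMING: a structural partial
result on an open crux of route `PolyaContinued`; nothing here bears on `VP ≠ VNP`. [folklore] -/
theorem freeEdgeAdditivity_rankOne (n d : ℕ) (E : Finset (Fin n × Fin n))
    (P : MvPolynomial (Fin n × Fin n) ℂ)
    (_hP : P = (Matrix.of fun i j => if (i, j) ∈ E then MvPolynomial.X (i, j) else 0 :
      Matrix (Fin n) (Fin n) (MvPolynomial (Fin n × Fin n) ℂ)).permanent)
    (hdeg : 1 ≤ P.totalDegree) {m : ℕ}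
    (L : Matrix (Fin m) (Fin m) (MvPolynomial (Fin n × Fin n) ℂ)) (hL : ∀ i j, (L i j).totalDegree ≤ 1)
    (u v : Fin d → Fin m → ℂ)
    (h : (rankOneForm L u v).det =
      MvPolynomial.rename Sum.inl P * ∏ i : Fin d, MvPolynomial.X (Sum.inr i)) :
    determinantalComplexity P + d ≤ m :=
  dc_add_le_of_rankOneForm P hdeg L hL u v h

end Crux

end Summit.ValiantsHypothesis.ValiantsHypothesis.Theorems.PolyaContinued.FreeEdgeRankOne

end
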